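import Literature.Topology.FourManifolds.FlatHost
import HarnessLib

/-!
# The hosts of the flip frames form an isotopic family

Topic `Literature/Topology/FourManifolds` (trunk T-4MAN). Fact seat
`provefact-Literature.Topology.FourManifolds.Knot.IsConnectedSum.isIsotopic` (Schubert's theorem),
geometric heart for rail knots. For a flip pair at a flat scale (`FlatHost.FlatHyp`) the hosts
`FlatHyp.host hu` of the spiked flip frames (family parameter `u ∈ [0, 1]`: without / with the
chord of the deep arc) are isotopic (`FlatHyp.isIsotopic_host_zero_one`). On the native zone
`[s⋆, nEnd]` (which contains the content, the window and the collars) all the host loops coincide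
(`FlatHost.hostLoop_eq_zone1`–`5` read the host through `u`-free formulas), and off it they are the
spiked flip frames themselves, a jointly `C^∞` family (`FlipWall.contDiff_flipSpikedC`); so the
host loops are a jointly `C^∞` family of simple regular loops and the family lemma
(`CurveFamilyIsotopy`) applies.

Everything is proved; no named facts are introduced.

## References

* M. W. Hirsch, *Differential Topology*, GTM 33 (1976), Ch. 8 §1, Thm. 1.3. [HirschDT1976]
-/

open scoped Manifold ContDiff Topology Real
open Function Set Metric Filter

noncomputable section

namespace Literature.Topology.FourManifolds

/-- Local notation: `𝔼 n` is the model Euclidean space `EuclideanSpace ℝ (Fin n)`. -/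
local notation "𝔼 " n:arg => EuclideanSpace ℝ (Fin n)

/-- Local notation: `𝕊 n` is the unit sphere in `EuclideanSpace ℝ (Fin (n + 1))`. -/
local notation "𝕊 " n:arg => (Metric.sphere (0 : EuclideanSpace ℝ (Fin (n + 1))) 1)

attribute [local instance] fact_finrank_euclideanSpace_succ

open KnotsInBall ExitBend ModelTemplate

namespace BandData

/-- Periodisations of functions agreeing on the fundamental domain agree. [folklore] -/
theorem periodise_congr' {X : Type*} {a : ℝ} {F G : ℝ → X} (h : ∀ t ∈ Ico a (a + 1), F t = G t) :
    periodise a F = periodise a G := by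
  funext t
  exact h _ (toIcoMod_one_mem a t)

variable {A₁ B₁ K₁ : Knot} {b₁ : BandData A₁ B₁ K₁ ∅} {A₂ B₂ K₂ : Knot} {b₂ : BandData A₂ B₂ K₂ ∅}
  {hcross₁ : b₁.band ⁻¹' sphereEquator 2 ∩ squareNhd b₁.δ = {x ∈ squareNhd b₁.δ | x 0 = 2⁻¹}}
  {hcross₂ : b₂.band ⁻¹' sphereEquator 2 ∩ squareNhd b₂.δ = {x ∈ squareNhd b₂.δ | x 0 = 2⁻¹}}

namespace FlatHyp

variable {ε₁ r₁ A₁' ε₂ r₂ ε₁' r₁' κ : ℝ} (H : FlatHyp hcross₁ hcross₂ ε₁ r₁ A₁' ε₂ r₂ ε₁' r₁' κ)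
include H

/-! ### The host piece functions -/

/-- The host piece function at parameter `u`. [folklore] -/
def hostPiece {u : ℝ} (hu : u ∈ Icc (0 : ℝ) 1) : ℝ → 𝔼 4 :=
  b₁.hostPiece H.HU half_mem01 (by norm_num) (H.isWallFrame hu) (rA := 1 / 8) eighth_pos H.hB H.hAB

/-- The host loop is the periodised host piece function. [folklore] -/
theorem hostLoop_eq_periodise {u : ℝ} (hu : u ∈ Icc (0 : ℝ) 1) : H.hostLoop hu = periodise b₁.alo (H.hostPiece hu) := rfl

/-- On the fundamental domain the host loop is the host piece function. [folklore] -/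
theorem hostLoop_of_mem {u : ℝ} (hu : u ∈ Icc (0 : ℝ) 1) {t : ℝ} (ht : t ∈ Ico b₁.alo (b₁.alo + 1)) :
    H.hostLoop hu t = H.hostPiece hu t :=
  periodise_eq_self _ _ ht

/-- **On `[s⋆, sJ]` all the host loops coincide** (they are read through `u`-free formulas).
[folklore] -/
theorem hostLoop_eq_hostLoop {u u' : ℝ} (hu : u ∈ Icc (0 : ℝ) 1) (hu' : u' ∈ Icc (0 : ℝ) 1) {t : ℝ} (ht : t ∈ Icc H.sStar H.sJ) :
    H.hostLoop hu t = H.hostLoop hu' t := by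
  rcases lt_or_ge t H.jLo with h1 | h1
  · rw [H.hostLoop_eq_zone1 hu ⟨ht.1, h1⟩, H.hostLoop_eq_zone1 hu' ⟨ht.1, h1⟩]
  rcases le_or_gt t H.w₁ with h2 | h2
  · rw [H.hostLoop_eq_zone2 hu ⟨h1, h2⟩, H.hostLoop_eq_zone2 hu' ⟨h1, h2⟩]
  rcases le_or_gt t H.w₂ with h3 | h3
  · rw [H.hostLoop_eq_zone3 hu ⟨h2.le, h3⟩, H.hostLoop_eq_zone3 hu' ⟨h2.le, h3⟩]
  rcases le_or_gt t H.jHi with h4 | h4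
  · rw [H.hostLoop_eq_zone4 hu ⟨h3, h4⟩, H.hostLoop_eq_zone4 hu' ⟨h3, h4⟩]
  · rw [H.hostLoop_eq_zone5 hu ⟨h4, ht.2⟩, H.hostLoop_eq_zone5 hu' ⟨h4, ht.2⟩]

/-- **Off the content (on the fundamental domain) the host loop is the frame.** [folklore] -/
theorem hostLoop_eq_frame {u : ℝ} (hu : u ∈ Icc (0 : ℝ) 1) {t : ℝ} (ht : t ∈ Ico b₁.alo (b₁.alo + 1)) (hts : t ∉ Icc H.jLo H.jHi) :
    H.hostLoop hu t = H.frame u t := by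
  obtain ⟨m1, m2, m3, m4, m5, m6, m7, m8, m9, m10, m11, -⟩ := H.marks
  have hc : t ∉ Ioo H.p₁ H.p₅ := fun h ↦ hts ⟨by linarith [h.1], by linarith [h.2]⟩
  rw [H.hostLoop_eq_bent hu ht hc, H.coe_bent_of_not_mem hu ht hts]

/-- On `(parLo₁ (-7/2), jLo)` every host loop is the spiked piece function. [folklore] -/
theorem hostLoop_eq_spikePiece_lo {u : ℝ} (hu : u ∈ Icc (0 : ℝ) 1) {t : ℝ}
    (ht : t ∈ Ioo (b₁.parLo H.κ_pos H.h7 neg_seven_halves_mem) H.jLo) : H.hostLoop hu t = b₁.spikePiece hcross₁ κ b₁.depthSign 1 t := by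
  obtain ⟨m1, m2, m3, m4, m5, m6, m7, m8, m9, m10, m11, -⟩ := H.marks
  have hp := (b₁.parLo_mem_core H.κ_pos H.h7 neg_seven_halves_mem).1
  have hcm := b₁.core_marks
  have hI : t ∈ Ico b₁.alo (b₁.alo + 1) := ⟨by linarith [ht.1], by linarith [ht.2]⟩
  rw [H.hostLoop_eq_frame hu hI (fun h ↦ by linarith [h.1, ht.2]), H.frame_eq_spikePiece u ⟨ht.1.le, by linarith [ht.2]⟩]

/-- On `(jHi, sJ)` every host loop is the spiked piece function. [folklore] -/
theorem hostLoop_eq_spikePiece_hi {u : ℝ} (hu : u ∈ Icc (0 : ℝ) 1) {t : ℝ} (ht : t ∈ Ioo H.jHi H.sJ) :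
    H.hostLoop hu t = b₁.spikePiece hcross₁ κ b₁.depthSign 1 t := by
  obtain ⟨m1, m2, m3, m4, m5, m6, m7, m8, m9, m10, m11, -⟩ := H.marks
  have hI : t ∈ Ico b₁.alo (b₁.alo + 1) := ⟨by linarith [ht.1], by linarith [ht.2]⟩
  have h72 := b₁.parLo_le_parLo H.κ_pos H.h7 neg_seven_halves_mem neg_one_mem (by norm_num)
  have hss : H.sStar = b₁.parLo H.κ_pos H.h7 neg_one_mem := rfl
  rw [H.hostLoop_eq_frame hu hI (fun h ↦ by linarith [h.2, ht.1]), H.frame_eq_spikePiece u ⟨by linarith [ht.1], ht.2.le⟩]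

/-! ### The family piece function -/

/-- **The family piece function**: the host piece function of `u = 0` on `[s⋆, nEnd]`, the spiked
flip frame of parameter `u` elsewhere. [folklore] -/
def famPiece (u t : ℝ) : 𝔼 4 := if t ∈ Icc H.sStar H.nEnd then H.hostPiece zero_mem01 t else H.frame u t

/-- On `[s⋆, nEnd]`. [folklore] -/
theorem famPiece_of_mem (u : ℝ) {t : ℝ} (ht : t ∈ Icc H.sStar H.nEnd) : H.famPiece u t = H.hostPiece zero_mem01 t := by
  simp [famPiece, ht]

/-- Off `[s⋆, nEnd]`. [folklore] -/
theorem famPiece_of_not_mem (u : ℝ) {t : ℝ} (ht : t ∉ Icc H.sStar H.nEnd) : H.famPiece u t = H.frame u t := by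
  simp [famPiece, ht]

/-- **Near `s⋆` the family piece function is the spiked piece function**, whatever the branch.
[folklore] -/
theorem famPiece_eq_spikePiece_lo (u : ℝ) {t : ℝ} (ht : t ∈ Ioo (b₁.parLo H.κ_pos H.h7 neg_seven_halves_mem) H.jLo) :
    H.famPiece u t = b₁.spikePiece hcross₁ κ b₁.depthSign 1 t := by
  obtain ⟨m1, m2, m3, m4, m5, m6, m7, m8, m9, m10, m11, -⟩ := H.marks
  by_cases h : t ∈ Icc H.sStar H.nEnd
  · have hp := (b₁.parLo_mem_core H.κ_pos H.h7 neg_seven_halves_mem).1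
    have hcm := b₁.core_marks
    have hI : t ∈ Ico b₁.alo (b₁.alo + 1) := ⟨by linarith [ht.1], by linarith [ht.2]⟩
    rw [H.famPiece_of_mem u h, ← H.hostLoop_of_mem zero_mem01 hI, H.hostLoop_eq_spikePiece_lo zero_mem01 ht]
  · rw [H.famPiece_of_not_mem u h, H.frame_eq_spikePiece u ⟨ht.1.le, by linarith [ht.2]⟩]

/-- **Near `nEnd` the family piece function is the spiked piece function**, whatever the branch.
[folklore] -/
theorem famPiece_eq_spikePiece_hi (u : ℝ) {t : ℝ} (ht : t ∈ Ioo H.jHi H.sJ) :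
    H.famPiece u t = b₁.spikePiece hcross₁ κ b₁.depthSign 1 t := by
  obtain ⟨m1, m2, m3, m4, m5, m6, m7, m8, m9, m10, m11, -⟩ := H.marks
  by_cases h : t ∈ Icc H.sStar H.nEnd
  · have hI : t ∈ Ico b₁.alo (b₁.alo + 1) := ⟨by linarith [ht.1], by linarith [ht.2]⟩
    rw [H.famPiece_of_mem u h, ← H.hostLoop_of_mem zero_mem01 hI, H.hostLoop_eq_spikePiece_hi zero_mem01 ht]
  · have h72 := b₁.parLo_le_parLo H.κ_pos H.h7 neg_seven_halves_mem neg_one_mem (by norm_num)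
    have hss : H.sStar = b₁.parLo H.κ_pos H.h7 neg_one_mem := rfl
    rw [H.famPiece_of_not_mem u h, H.frame_eq_spikePiece u ⟨by linarith [ht.1], ht.2.le⟩]

/-- The frame family is jointly `C^∞`. [folklore] -/
theorem contDiff_frame_uncurry : ContDiff ℝ ∞ (uncurry H.frame) := contDiff_flipSpikedC H.arc H.HU.cone H.pair

/-- The host piece function of `u = 0` is `C^∞`. [folklore] -/
theorem contDiff_hostPiece_zero : ContDiff ℝ ∞ (H.hostPiece zero_mem01) :=
  b₁.contDiff_hostPiece H.HU half_mem01 (by norm_num) (H.isWallFrame zero_mem01) (rA := 1 / 8) eighth_pos H.hB H.hAB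

/-- The spiked piece function is `C^∞`. [folklore] -/
theorem contDiff_spikePiece : ContDiff ℝ ∞ (b₁.spikePiece hcross₁ κ b₁.depthSign 1) :=
  b₁.contDiff_spikePiece_stage hcross₁ H.κ_pos H.eight_le₁ b₁.depthSign 1

/-- **THE FAMILY PIECE FUNCTION IS JOINTLY `C^∞`.** [folklore] -/
theorem contDiff_famPiece : ContDiff ℝ ∞ (uncurry H.famPiece) := by
  obtain ⟨m1, m2, m3, m4, m5, m6, m7, m8, m9, m10, m11, -⟩ := H.marks
  have h72 : b₁.parLo H.κ_pos H.h7 neg_seven_halves_mem < H.sStar :=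
    b₁.parLo_lt_parLo H.κ_pos H.h7 neg_seven_halves_mem neg_one_mem (by norm_num)
  have hsp : ContDiff ℝ ∞ fun x : ℝ × ℝ ↦ b₁.spikePiece hcross₁ κ b₁.depthSign 1 x.2 := H.contDiff_spikePiece.comp contDiff_snd
  have hhp : ContDiff ℝ ∞ fun x : ℝ × ℝ ↦ H.hostPiece zero_mem01 x.2 := H.contDiff_hostPiece_zero.comp contDiff_snd
  have hfr : ContDiff ℝ ∞ fun x : ℝ × ℝ ↦ H.frame x.1 x.2 := H.contDiff_frame_uncurry
  have hopen_lt : ∀ c : ℝ, IsOpen {x : ℝ × ℝ | x.2 < c} := fun c ↦ isOpen_lt continuous_snd continuous_const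
  have hopen_gt : ∀ c : ℝ, IsOpen {x : ℝ × ℝ | c < x.2} := fun c ↦ isOpen_lt continuous_const continuous_snd
  refine contDiff_iff_contDiffAt.2 fun x ↦ ?_
  rcases lt_or_ge x.2 H.sStar with h1 | h1
  · -- left of `s⋆`: the frame
    exact hfr.contDiffAt.congr_of_eventuallyEq (by
      filter_upwards [(hopen_lt H.sStar).mem_nhds h1] with y hy using H.famPiece_of_not_mem y.1 (fun h ↦ by linarith [h.1, show y.2 < H.sStar from hy]))
  rcases lt_or_ge x.2 H.jLo with h2 | h2
  · -- near `s⋆`: the spiked piece function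
    exact hsp.contDiffAt.congr_of_eventuallyEq (by
      filter_upwards [(hopen_gt _).mem_nhds (show b₁.parLo H.κ_pos H.h7 neg_seven_halves_mem < x.2 by linarith),
        (hopen_lt H.jLo).mem_nhds h2] with y hy hy' using H.famPiece_eq_spikePiece_lo y.1 ⟨hy, hy'⟩)
  rcases le_or_gt x.2 H.jHi with h3 | h3
  · -- inside: the host piece of `u = 0`
    exact hhp.contDiffAt.congr_of_eventuallyEq (by
      filter_upwards [(hopen_gt H.sStar).mem_nhds (show H.sStar < x.2 by linarith), (hopen_lt H.nEnd).mem_nhds (show x.2 < H.nEnd by linarith)]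
        with y hy hy' using H.famPiece_of_mem y.1 ⟨le_of_lt hy, le_of_lt hy'⟩)
  rcases lt_or_ge x.2 H.sJ with h4 | h4
  · -- near `nEnd`: the spiked piece function
    exact hsp.contDiffAt.congr_of_eventuallyEq (by
      filter_upwards [(hopen_gt H.jHi).mem_nhds h3, (hopen_lt H.sJ).mem_nhds h4] with y hy hy' using H.famPiece_eq_spikePiece_hi y.1 ⟨hy, hy'⟩)
  · -- right of `nEnd`: the frame
    exact hfr.contDiffAt.congr_of_eventuallyEq (by
      filter_upwards [(hopen_gt H.nEnd).mem_nhds (show H.nEnd < x.2 by linarith)] with y hy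
        using H.famPiece_of_not_mem y.1 (fun h ↦ by linarith [h.2, show H.nEnd < y.2 from hy]))

/-- The switch zone lies in `[alo + seamEps, alo + 1 - seamEps]`. [folklore] -/
theorem zone_subset : Icc H.sStar H.nEnd ⊆ Icc (b₁.alo + b₁.seamEps) (b₁.alo + 1 - b₁.seamEps) := by
  have hs : H.sStar ∈ b₁.spikeSet κ := Or.inl ⟨H.sStar_mem_core, by rw [H.alphaLo_sStar]; exact ⟨le_rfl, by norm_num⟩⟩
  have hne : H.nEnd = b₁.parHi H.κ_pos H.h7' neg_one_mem := rfl
  have hn : H.nEnd ∈ b₁.spikeSet κ :=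
    Or.inr ⟨b₁.parHi_mem_core H.κ_pos H.h7' neg_one_mem, by rw [hne, b₁.alphaHi_parHi H.κ_pos H.h7' neg_one_mem]; exact ⟨le_rfl, by norm_num⟩⟩
  have h1 := b₁.spikeSet_subset κ hs
  have h2 := b₁.spikeSet_subset κ hn
  exact fun t ht ↦ ⟨h1.1.trans ht.1, ht.2.trans h2.2⟩

/-- The frame has the seam property for every `u`. [folklore] -/
theorem frame_seam (u : ℝ) : ∀ t ∈ Ioo (b₁.alo - b₁.seamEps) (b₁.alo + b₁.seamEps), H.frame u (t + 1) = H.frame u t :=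
  seam_of_eqOn_compl (flipBase_seam H.HU.cone.spike H.arc u) (b₁.spikeSupp_subset κ) fun _ ht ↦
    b₁.spikeFam_of_not_mem H.HU.cone.spike _ 1 ht

/-- **The family piece function has the seam property for every `u`.** [folklore] -/
theorem famPiece_seam (u : ℝ) : ∀ t ∈ Ioo (b₁.alo - b₁.seamEps) (b₁.alo + b₁.seamEps), H.famPiece u (t + 1) = H.famPiece u t :=
  seam_of_eqOn_compl (H.frame_seam u) H.zone_subset fun _ ht ↦ H.famPiece_of_not_mem u ht

/-- **For `u ∈ [0, 1]` the periodised family piece function is the host loop.** [folklore] -/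
theorem periodise_famPiece {u : ℝ} (hu : u ∈ Icc (0 : ℝ) 1) : periodise b₁.alo (H.famPiece u) = H.hostLoop hu := by
  obtain ⟨m1, m2, m3, m4, m5, m6, m7, m8, m9, m10, m11, -⟩ := H.marks
  rw [H.hostLoop_eq_periodise hu]
  refine periodise_congr' fun t ht ↦ ?_
  by_cases h : t ∈ Icc H.sStar H.nEnd
  · rw [H.famPiece_of_mem u h, ← H.hostLoop_of_mem zero_mem01 ht, ← H.hostLoop_of_mem hu ht]
    exact H.hostLoop_eq_hostLoop zero_mem01 hu ⟨h.1, by linarith [h.2]⟩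
  · rw [H.famPiece_of_not_mem u h, ← H.hostLoop_of_mem hu ht]
    exact (H.hostLoop_eq_frame hu ht (fun h' ↦ h ⟨by linarith [h'.1], by linarith [h'.2]⟩)).symm

/-- **THE HOSTS OF THE FLIP FRAMES AT `u = 0` AND `u = 1` ARE ISOTOPIC.**
[cite: HirschDT1976, Ch. 8 §1, Thm. 1.3] -/
theorem isIsotopic_host_zero_one : (H.host zero_mem01).IsIsotopic (H.host one_mem01) := by
  have hC : ContDiff ℝ ∞ (uncurry fun u t ↦ periodise b₁.alo (H.famPiece u) t) :=
    contDiff_periodise_family H.contDiff_famPiece b₁.seamEps_bounds.1 H.famPiece_seam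
  have hreg : ∀ u ∈ Icc (0 : ℝ) 1, IsRegularLoop fun t ↦ periodise b₁.alo (H.famPiece u) t := fun u hu ↦ by
    rw [show (fun t ↦ periodise b₁.alo (H.famPiece u) t) = H.hostLoop hu from H.periodise_famPiece hu]
    exact H.isRegularLoop_hostLoop hu
  have hinj : ∀ u ∈ Icc (0 : ℝ) 1, ∀ s t, periodise b₁.alo (H.famPiece u) s = periodise b₁.alo (H.famPiece u) t → ∃ m : ℤ, t - s = m :=
    fun u hu s t h ↦ H.hostLoop_inj hu s t (by rw [← H.periodise_famPiece hu]; exact h)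
  have h := IsRegularLoop.isIsotopic_of_family_eq (H.isRegularLoop_hostLoop zero_mem01) (H.isRegularLoop_hostLoop one_mem01)
    (H.hostLoop_inj zero_mem01) (H.hostLoop_inj one_mem01) (C := fun u t ↦ periodise b₁.alo (H.famPiece u) t) hC hreg hinj
    (H.periodise_famPiece zero_mem01) (H.periodise_famPiece one_mem01)
  rw [host_eq_toKnot, host_eq_toKnot]
  exact h

end FlatHyp

end BandData

end Literature.Topology.FourManifolds
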